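import Literature.Barriers.CriticalPhenomena.TimarSurgery
import HarnessLib

/-!
# Timár 2006, Lemma 5.3 (first part) for the bad clusters: with infinitely many bad heavy
# clusters, encounter points of bad heavy clusters occur with positive probability — PROVED

Barrier catalogue `Literature/Barriers/CriticalPhenomena/`; a brick of the programme proving
Timár's Thm. 5.5 (`Timar2006_finiteLevelUnion`, `TimarCriticalNonunimodular.lean`), the
probabilistic wrapper of the deterministic surgery of `TimarSurgery.lean`. Á. Timár, Ann. Probab.
34 (2006) 2344–2364, §5: Lemma 5.3 ("Suppose that there are infinitely many heavy clusters in
`ω`. Then every heavy cluster in `ω` contains infinitely many encounter points. … *Proof.* The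
existence of encounter points follows from insertion tolerance") applied, in the proof of
Thm. 5.5, to the invariant subgraph `ω̄` of the bad heavy clusters ("By Lemma 5.3, there are
encounter points in `ω̄`, hence any `L₀` contains an encounter point with positive probability").

We PROVE (`not_ae_forall_not_badEncounter`): under Bernoulli(`p`) bond percolation with
`0 < p < 1` on a connected, locally finite graph, if almost surely there are infinitely many bad
heavy clusters (`badHeavyClusters`, `TimarBadClusters.lean`), then it is NOT the case that
almost surely no vertex is an encounter point of a bad heavy cluster. Proof (Lyons–Peres 2016,
proof of Thm. 7.6, as prepared in `TimarSurgery.lean`): with positive probability three fixed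
vertices `v₁, v₂, v₃` lie in distinct bad heavy clusters (`le_encard_badHeavyClusters_iff`,
countability); inside the ball `K = B(o, r)` containing them, each of these clusters leaves the
ball through a sphere vertex whose pruned cluster is heavy (`exists_sphere_isHeavy_pruned`, from
`openCluster_subset_closeEdges_edgesAt` and `IsHeavy.exists_isHeavy_inter`); fixing the three
sphere vertices `a, b, c` (countability again), the tripod surgery of `TimarSurgery.lean` produces
a bad cluster at `o` with an encounter point `m ∈ K` (`isBad_surgery_tripod`,
`isEncounter_surgery_tripod`), and deletion/insertion tolerance
(`bondPercolation_real_pos_of_closeEdges`, `bondPercolation_real_pos_of_openEdges`) transports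
positivity to the event "some `m ∈ K` is an encounter point of a bad heavy cluster".

## References

* Á. Timár, Ann. Probab. 34 (2006) 2344–2364 (arXiv:math/0702875), §5, Lemma 5.3 (proof: "The
  existence of encounter points follows from insertion tolerance"), Thm. 5.5 (proof: `ω̄`).
  [Timar2006]
* R. Lyons, Y. Peres, *Probability on Trees and Networks*, CUP 2016, proof of Thm. 7.6.
  [LyonsPeres2016]
-/

noncomputable section

namespace Literature.Barriers.CriticalPhenomena

open _root_.MeasureTheory Literature.Probability.Percolation SimpleGraph
open scoped ENNReal

variable {V : Type*} {G : SimpleGraph V} [G.LocallyFinite]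

/-! ### Heavy clusters leave a ball through heavy pruned clusters of sphere vertices -/

/-- **A heavy cluster meeting the ball leaves it through a sphere vertex whose pruned cluster is
heavy** (and lies inside the cluster): `C_ω(x) ⊆ K ∪ ⋃_{z ∈ {x} ∪ N(K)} C_{ω∖E_K}(z)`
(`openCluster_subset_closeEdges_edgesAt`), one piece is heavy (`IsHeavy.exists_isHeavy_inter`),
its centre is off `K` (`closeEdges_edgesAt_piece`) and a neighbour of `K`, hence on the sphere.
[cite: LyonsPeres2016, Thm. 7.6 (proof: the clusters meeting the ball)] -/
theorem exists_sphere_isHeavy_pruned [DecidableEq V] (hconn : G.Connected) {o : V} {r : ℕ} {ω : BondConfig V}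
    (hω : ω ⊆ G.edgeSet) {x : V} (hx : x ∈ ballVerts G o r) (hH : IsHeavy G o (openCluster ω x)) :
    ∃ s ∈ sphereVerts G o r, IsHeavy G o (openCluster (prunedConfig G o r ω) s) ∧
      openCluster (prunedConfig G o r ω) s ⊆ openCluster ω x := by
  classical
  set K := ballVerts G o r with hK
  have hcov := openCluster_subset_closeEdges_edgesAt (G := G) (K := K) hω x
  obtain ⟨z, hz, hpiece⟩ := IsHeavy.exists_isHeavy_inter hconn hH K.finite_toSet _ _ hcov
  obtain ⟨hzK, hzH, -, hzsub⟩ := closeEdges_edgesAt_piece hconn hω hpiece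
  have hzs : z ∈ sphereVerts G o r := by
    rw [Finset.mem_insert] at hz
    rcases hz with rfl | hz
    · exact absurd hx hzK
    · rw [Finset.mem_biUnion] at hz
      obtain ⟨k, hk, hzk⟩ := hz
      exact mem_sphereVerts_of_adj hconn hk hzK ((G.mem_neighborFinset k z).1 hzk)
  exact ⟨z, hzs, hzH, hzsub⟩

/-! ### The events -/

section Events

variable [Countable V]

/-- A countable family of null sets does not cover a set of full measure. [folklore] -/
theorem exists_measure_pos_of_ae_mem_iUnion {Ω ι : Type*} [MeasurableSpace Ω] [Countable ι]
    {μ : Measure Ω} [IsProbabilityMeasure μ] {E : ι → Set Ω} (h : ∀ᵐ ξ ∂μ, ξ ∈ ⋃ i, E i) :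
    ∃ i, μ (E i) ≠ 0 := by
  by_contra hno
  push Not at hno
  have h0 : μ (⋃ i, E i) = 0 := measure_iUnion_null hno
  have h1 : μ (⋃ i, E i)ᶜ = 0 := by
    rw [ae_iff] at h
    exact h
  have : μ Set.univ = 0 := by
    rw [← Set.union_compl_self (⋃ i, E i)]
    exact measure_union_null h0 h1
  exact one_ne_zero (measure_univ.symm.trans this)

end Events

/-! ### Lemma 5.3, first part, for the bad clusters -/

/-- **Timár 2006, Lemma 5.3 (first part) for the bad clusters, PROVED**: under Bernoulli(`p`)
bond percolation with `0 < p < 1` on a connected, locally finite graph, if almost surely there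
are infinitely many bad heavy clusters, then with positive probability some vertex is an
encounter point of a bad heavy cluster — it is not the case that almost surely no vertex has a
heavy, bad cluster of which it is an encounter point. See the module docstring for the proof.
[cite: Timar2006, Lemma 5.3 (proof: "The existence of encounter points follows from insertion tolerance") and Thm. 5.5 (proof: encounter points in ω̄)] -/
theorem not_ae_forall_not_badEncounter [Countable V] (hconn : G.Connected) (o : V)
    {p : unitInterval} (hp0 : 0 < (p : ℝ)) (hp1 : (p : ℝ) < 1)
    (hbad : ∀ᵐ ω ∂(bondPercolation G p), (badHeavyClusters G o ω).Infinite) :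
    ¬ ∀ᵐ ω ∂(bondPercolation G p), ∀ x,
      ¬ (IsHeavy G o (openCluster ω x) ∧ LevelBad G ω x ∧ IsEncounter G o ω x) := by
  classical
  intro hno
  set μ := bondPercolation G p with hμ
  -- Step 1: three fixed vertices in distinct bad heavy clusters, with positive probability
  set E₀ : V × V × V → Set (BondConfig V) := fun v => {ω | ω ⊆ G.edgeSet ∧
      IsBad G o ω v.1 ∧ IsBad G o ω v.2.1 ∧ IsBad G o ω v.2.2 ∧
      ¬ (openGraph ω).Reachable v.1 v.2.1 ∧ ¬ (openGraph ω).Reachable v.1 v.2.2 ∧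
      ¬ (openGraph ω).Reachable v.2.1 v.2.2} with hE₀
  have hcov₀ : ∀ᵐ ω ∂μ, ω ∈ ⋃ v, E₀ v := by
    filter_upwards [hbad, (ProbabilityTheory.setBernoulli_ae_subset : ∀ᵐ ω ∂μ, ω ⊆ G.edgeSet)]
      with ω hinf hωE
    have h3 : ((3 : ℕ) : ℕ∞) ≤ (badHeavyClusters G o ω).encard := by
      rw [Set.encard_eq_top_iff.2 hinf]; exact le_top
    obtain ⟨s, hs3, hsbad, hpw⟩ := (le_encard_badHeavyClusters_iff G o ω 3).1 h3
    obtain ⟨x, y, z, hxy, hxz, hyz, rfl⟩ := Finset.card_eq_three.1 hs3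
    have hx : x ∈ ({x, y, z} : Finset V) := by simp
    have hy : y ∈ ({x, y, z} : Finset V) := by simp
    have hz : z ∈ ({x, y, z} : Finset V) := by simp
    exact Set.mem_iUnion.2 ⟨(x, y, z), hωE, hsbad x hx, hsbad y hy, hsbad z hz,
      hpw hx hy hxy, hpw hx hz hxz, hpw hy hz hyz⟩
  obtain ⟨v, hv⟩ := exists_measure_pos_of_ae_mem_iUnion hcov₀
  obtain ⟨v₁, v₂, v₃⟩ := v
  -- the ball containing the three vertices
  set r : ℕ := max (G.dist o v₁) (max (G.dist o v₂) (G.dist o v₃)) with hr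
  have hv₁ : v₁ ∈ ballVerts G o r := by rw [mem_ballVerts_iff hconn]; omega
  have hv₂ : v₂ ∈ ballVerts G o r := by rw [mem_ballVerts_iff hconn]; omega
  have hv₃ : v₃ ∈ ballVerts G o r := by rw [mem_ballVerts_iff hconn]; omega
  -- Step 2: fix the three sphere vertices
  set E₁ : V × V × V → Set (BondConfig V) := fun t => {ω | ω ⊆ G.edgeSet ∧
      t.1 ∈ sphereVerts G o r ∧ t.2.1 ∈ sphereVerts G o r ∧ t.2.2 ∈ sphereVerts G o r ∧
      t.1 ≠ t.2.1 ∧ t.1 ≠ t.2.2 ∧ t.2.1 ≠ t.2.2 ∧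
      (∀ x, (x = t.1 ∨ x = t.2.1 ∨ x = t.2.2) → IsHeavy G o (openCluster (prunedConfig G o r ω) x)) ∧
      (∀ x y, (x = t.1 ∨ x = t.2.1 ∨ x = t.2.2) → (y = t.1 ∨ y = t.2.1 ∨ y = t.2.2) → x ≠ y →
        y ∉ openCluster (prunedConfig G o r ω) x) ∧
      ∀ x, (x = t.1 ∨ x = t.2.1 ∨ x = t.2.2) → IsBad G o ω x} with hE₁
  have hcov₁ : E₀ (v₁, v₂, v₃) ⊆ ⋃ t, E₁ t := by
    rintro ω ⟨hωE, hb₁, hb₂, hb₃, h₁₂, h₁₃, h₂₃⟩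
    obtain ⟨a, ha, haH, haC⟩ := exists_sphere_isHeavy_pruned hconn hωE hv₁ hb₁.1
    obtain ⟨b, hb, hbH, hbC⟩ := exists_sphere_isHeavy_pruned hconn hωE hv₂ hb₂.1
    obtain ⟨c, hc, hcH, hcC⟩ := exists_sphere_isHeavy_pruned hconn hωE hv₃ hb₃.1
    have haω : a ∈ openCluster ω v₁ := haC (mem_openCluster_self _ a)
    have hbω : b ∈ openCluster ω v₂ := hbC (mem_openCluster_self _ b)
    have hcω : c ∈ openCluster ω v₃ := hcC (mem_openCluster_self _ c)
    -- two of `a, b, c` in one pruned cluster would join two of `v₁, v₂, v₃`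
    have key : ∀ {u w s t : V}, ¬ (openGraph ω).Reachable u w →
        openCluster (prunedConfig G o r ω) s ⊆ openCluster ω u → t ∈ openCluster ω w →
          t ∉ openCluster (prunedConfig G o r ω) s := by
      intro u w s t huw hsub htw hts
      exact huw ((show (openGraph ω).Reachable u t from hsub hts).trans
        (show (openGraph ω).Reachable w t from htw).symm)
    have key' : ∀ {u w s t : V}, ¬ (openGraph ω).Reachable u w →
        openCluster (prunedConfig G o r ω) s ⊆ openCluster ω u → t ∈ openCluster ω w → s ≠ t := by
      intro u w s t huw hsub htw hst
      exact key huw hsub htw (hst ▸ mem_openCluster_self _ s)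
    have h₂₁ : ¬ (openGraph ω).Reachable v₂ v₁ := fun h => h₁₂ h.symm
    have h₃₁ : ¬ (openGraph ω).Reachable v₃ v₁ := fun h => h₁₃ h.symm
    have h₃₂ : ¬ (openGraph ω).Reachable v₃ v₂ := fun h => h₂₃ h.symm
    refine Set.mem_iUnion.2 ⟨(a, b, c), hωE, ha, hb, hc, key' h₁₂ haC hbω, key' h₁₃ haC hcω,
      key' h₂₃ hbC hcω, ?_, ?_, ?_⟩
    · rintro x (rfl | rfl | rfl)
      · exact haH
      · exact hbH
      · exact hcH
    · rintro x y (rfl | rfl | rfl) (rfl | rfl | rfl) hxy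
      · exact absurd rfl hxy
      · exact key h₁₂ haC hbω
      · exact key h₁₃ haC hcω
      · exact key h₂₁ hbC haω
      · exact absurd rfl hxy
      · exact key h₂₃ hbC hcω
      · exact key h₃₁ hcC haω
      · exact key h₃₂ hcC hbω
      · exact absurd rfl hxy
    · rintro x (rfl | rfl | rfl)
      · exact (isBad_of_mem haω).2 hb₁
      · exact (isBad_of_mem hbω).2 hb₂
      · exact (isBad_of_mem hcω).2 hb₃
  obtain ⟨t, ht⟩ : ∃ t, μ (E₁ t) ≠ 0 := by
    by_contra hno'
    push Not at hno'
    exact hv (measure_mono_null hcov₁ (measure_iUnion_null hno'))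
  obtain ⟨a, b, c⟩ := t
  -- Step 3: the tripod surgery and finite energy
  set T : Set (Sym2 V) := tripodEdges hconn o a b c with hT
  have hTfin : T.Finite :=
    ((chainEdges_finite hconn a).union (chainEdges_finite hconn b)).union (chainEdges_finite hconn c)
  set TF : Finset (Sym2 V) := hTfin.toFinset with hTF
  have hTFT : (↑TF : Set (Sym2 V)) = T := hTfin.coe_toFinset
  have hTFE : (↑TF : Set (Sym2 V)) ⊆ G.edgeSet := hTFT ▸ tripodEdges_subset_edgeSet hconn o a b c
  -- the target event: an encounter point of a bad heavy cluster inside the ball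
  set F : Set (BondConfig V) := ⋃ m ∈ ballVerts G o r,
      {ω | IsHeavy G o (openCluster ω m) ∧ LevelBad G ω m ∧ IsEncounter G o ω m} with hF
  have hFm : MeasurableSet F := by
    refine Finset.measurableSet_biUnion _ fun m _ => ?_
    exact (measurableSet_isHeavy_openCluster G o m).inter
      ((measurableSet_levelBad G m).inter (measurableSet_isEncounter G o m))
  have hF0 : μ F = 0 := by
    refine measure_mono_null ?_ (ae_iff.1 hno)
    intro ω hω hall
    obtain ⟨m, -, hm⟩ := Set.mem_iUnion₂.1 hω
    exact hall m hm
  -- the surgery maps `E₁ (a, b, c)` into `F`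
  have hmap : ∀ ω ∈ E₁ (a, b, c), openEdges ↑TF (closeEdges ↑(ballEdges G o r) ω) ∈ F := by
    rintro ω ⟨hωE, ha, hb, hc, hab, hac, hbc, hheavy, hdistinct, hbad3⟩
    have hsurg : openEdges ↑TF (closeEdges ↑(ballEdges G o r) ω) = surgery G o r T ω := by
      rw [hTFT]; rfl
    rw [hsurg]
    obtain ⟨m, hmK, hmo, hmE⟩ := isEncounter_surgery_tripod hconn hωE ha hb hc hab hac hbc hheavy hdistinct
    have hbado : IsBad G o (surgery G o r T ω) o :=
      isBad_surgery_tripod hconn hωE ha hb hc (hheavy a (Or.inl rfl)) hbad3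
    have hbadm : IsBad G o (surgery G o r T ω) m := (isBad_of_mem hmo).2 hbado
    exact Set.mem_iUnion₂.2 ⟨m, hmK, hbadm.1, hbadm.2, hmE⟩
  have hpos : 0 < μ.real (E₁ (a, b, c)) := by
    rw [measureReal_def]; exact ENNReal.toReal_pos ht (measure_ne_top _ _)
  set E₂ : Set (BondConfig V) := openEdges ↑TF ⁻¹' F with hE₂
  have hE₂m : MeasurableSet E₂ := measurable_openEdges _ hFm
  have hpos₂ : 0 < μ.real E₂ :=
    bondPercolation_real_pos_of_closeEdges G hp1 (ballEdges G o r) hE₂m hpos fun ω hω => hmap ω hω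
  have hposF : 0 < μ.real F :=
    bondPercolation_real_pos_of_openEdges G hp0 TF hTFE hFm hpos₂ fun ω hω => hω
  rw [measureReal_def, hF0, ENNReal.toReal_zero] at hposF
  exact lt_irrefl _ hposF

end Literature.Barriers.CriticalPhenomena

end
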